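import Literature.NumberTheory.LFunctions.NicolasOmega
import Literature.NumberTheory.LFunctions.RHClassicalEquivalentsRobinProofs
import Literature.NumberTheory.LFunctions.QuasiRHFacts
import Literature.NumberTheory.LFunctions.NicolasMertensRHProofs
import Summits.RiemannHypothesis.Statement
import HarnessLib

/-!
# Splittings — Robin detectors III: ZERO-RESOLVED tail-rigidity — the margin ↔ abscissa exchange rate of Robin's
# criterion (SPLIT-robin-bridge gen 4; zero-definition raw form)

Cell rh-split, seat rh-split-robin-bridge g4 (brief sha16 f79c5f09d8bcb036), card `run/shared/lean/pub/rh-split/cards/SPLIT-robin-bridge.md`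
§10; raw form of `HOME/rh-split-robin-bridge/SketchG4.lean` (sha16 7b49bc801ce669e4, zero defs; proofs verbatim), filed by
rh-split-typer-1 g2 as an optional detector file next to `RobinSieveDetectors.lean` (p470053).  Typer replay: farm rc 0,
0 warnings, 0 sorry; `#print axioms rh_of_forall_marginTail_above` = [propext, Classical.choice, Quot.sound].
HONEST LABEL: «SPLITTING SEARCH over kernel-typed RH-EQUIVALENCES; a splitting A ∧ B ⟹ RH is CONDITIONAL bookkeeping
unless A and B are both proved; nothing here bears on the truth of RH.»

g0/g2/g3 used the tree's Ω-theorem only in its `∃ β < 1/2` form (`Robin1984_sigma_oscillation_holds`):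
«¬RH ⟹ margin-`β` violations beyond every cutoff», whence `TailRobin N → RH` for every `N` (margin 0).
The tree in fact proves the PER-ZERO Landau theorem (`Nicolas.exists_nicolasFn_neg_of_zero`: every zero
`ρ₀` right-most on its line and every `b ∈ (1 − Re ρ₀, 1/2)` force `g_{b,c} < 0` for arbitrarily large
`x`), i.e. Nicolas 1983 Thm. 3 (c) / Robin 1984 §4 Prop. 1 WITH the exponent window `1 − Θ < b < 1/2`.
This file types the consequence for the splitting matrix — the exchange rate between the MARGIN
exponent `b` of a weakened Robin tail and the zero-free ABSCISSA it certifies: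

  `MarginTail b C N` := `∀ n > N, σ(n) < e^γ n log log n + C·n·log log n/(log n)^b`   (raw, no def)

* `frequently_margin_le_sigma_of_zero` : a zero `ρ` with `Re ρ > 1 − b` (`0 < b < 1/2`) forces
      `σ(n) ≥ e^γ n log log n + n log log n/(log n)^b` for infinitely many `n` (per-zero Robin §4 Prop 1).
* `quasiRH_of_marginTail`      : `b < 1/2`, any real `C`: `MarginTail b C N → QuasiRiemannHypothesis (1 − b)`
      for EVERY `N` (the weakened tail certifies exactly the zero-free half-plane `Re s > 1 − b`).
* `rh_of_marginTail_of_half_le`: `b ≥ 1/2`: `MarginTail b C N → RiemannHypothesis` (margins at or below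
      the RH scale `(log n)^{-1/2}` are RH-strength; g0's `TailRobin N → RH` is the margin-0 case).
* (NOT here: the scratch's `marginTail_of_rh` / `rh_iff_forall_marginTail` / `summit_iff_forall_marginTail` — the
      RH ⟹ directions run through Robin's Thm 1, whose tree proof inherits the Mertens/Schoenfeld `native_decide`
      certificates; kept out so this file is on the standard axioms.)
* `bridge_pins_abscissa`       : `(QRH κ → MarginTail b C N) → (QRH κ → QRH (1 − b))` — the lens-(ii)
      no-go IN LEAN TERMS: a bridge from the weaker-than-RH conjecture `QRH κ` (`κ > 1/2`) to a margin-`b`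
      tail with `b > 1 − κ` would be a free zero-free STRIP theorem `QRH κ → QRH (1−b)`; bridges from
      `QRH κ` can land only at margin exponent `b ≤ 1 − κ` (and do, on paper: Robin §4 with `Θ ≤ κ`).
* `rh_of_forall_marginTail_above` : the induced RH-splitting `MarginTail b₀ ∧ ⋀_{b₀<b<1/2} MarginTail b`
      is MONOTONE costume — the second conjunct alone is RH.
* `quasiRH_of_logf_eventually_gt` : Nicolas's own face (1983 Thm 3 (c), contrapositive, per zero):
      `(∀ᶠ x, −c·x^{−b} < log f(x)) → QRH (1 − b)`.
-/

set_option linter.dupNamespace false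

noncomputable section

namespace Summit.RiemannHypothesis.RiemannHypothesis.Theorems.Splittings.RobinMarginTailDetectors

open Filter Real Complex Set
open scoped ArithmeticFunction.sigma
open Literature.NumberTheory.LFunctions
open Literature.NumberTheory.LFunctions.Nicolas

/-! ### 0. From ANY zero with `Re ρ > 1/2` to a right-most zero of `Z₁` on its line: the tree's
`Literature.NumberTheory.LFunctions.Nicolas.exists_zero_right_of_zero` (NicolasMertensRHProofs), used below. -/

/-! ### 1. Per-zero Robin oscillation: a zero with `Re ρ > 1 − b` forces margin-`b` violations i.o. -/

/-- **Robin 1984 §4 Prop. 1, zero-resolved** (Nicolas 1983 Thm 3 (c) window `1 − Θ < b < 1/2`): if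
`ζ(ρ) = 0` with `Re ρ > 1 − b`, `0 < b < 1/2`, then `σ(n) ≥ e^γ n log log n + n log log n/(log n)^b`
for infinitely many `n` (namely `n = lcm(1,…,⌊x⌋)` at the `x` where Nicolas's `g_{b,c₀} < 0`). -/
theorem frequently_margin_le_sigma_of_zero {b : ℝ} (hb0 : 0 < b) (hb : b < 1 / 2) {ρ : ℂ}
    (hρ : riemannZeta ρ = 0) (hre : 1 - b < ρ.re) :
    ∃ᶠ n : ℕ in atTop,
      rexp eulerMascheroniConstant * n * Real.log (Real.log n) +
          1 * n * Real.log (Real.log n) / Real.log n ^ b ≤ (σ 1 n : ℝ) := by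
  obtain ⟨s₀, hZ, hre1, hre2, hray⟩ := exists_zero_right_of_zero hρ (by linarith)
  have hre' : -b < s₀.re := by linarith
  rw [Filter.frequently_atTop]
  intro N₀
  obtain ⟨x, hxX, hgx⟩ :=
    exists_nicolasFn_neg_of_zero hb0 hb hZ hre' hray (6 + 4 / (1 / 2 - b)) (max ((N₀ : ℝ) + 1) 7)
  have hx7 : 7 ≤ x := le_trans (le_max_right _ _) hxX.le
  have hxN : (N₀ : ℝ) + 1 ≤ x := le_trans (le_max_left _ _) hxX.le
  refine ⟨Nat.lcmUpto ⌊x⌋₊, ?_, ?_⟩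
  · have h1 : N₀ ≤ ⌊x⌋₊ := by
      refine Nat.le_floor ?_
      linarith
    have h2 : ⌊x⌋₊ ≤ Nat.lcmUpto ⌊x⌋₊ := by
      refine Nat.le_of_dvd (Nat.lcmUpto_pos _) ?_
      have hmem : ⌊x⌋₊ ∈ Finset.Icc 1 ⌊x⌋₊ :=
        Finset.mem_Icc.2 ⟨Nat.le_floor (by push_cast; linarith), le_rfl⟩
      show ⌊x⌋₊ ∣ (Finset.Icc 1 ⌊x⌋₊).lcm id
      exact Finset.dvd_lcm hmem
    exact h1.trans h2
  · by_contra hlt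
    push Not at hlt
    have := nicolasFn_pos_of_sigma_lt hb0 hb hx7 hlt
    linarith

/-! ### 2. The exchange rate: a margin-`b` tail certifies the zero-free half-plane `Re s > 1 − b` -/

/-- Comparing two margins at one `n ≥ 3`: if `C ≤ (log n)^{b − b'}` then
`n log log n/(log n)^{b'} ≥ C n log log n/(log n)^b`. -/
theorem margin_le_of_le_rpow {b b' C : ℝ} {n : ℕ} (hn : 3 ≤ n)
    (hCn : C ≤ Real.log n ^ (b - b')) :
    C * n * Real.log (Real.log n) / Real.log n ^ b ≤
      1 * n * Real.log (Real.log n) / Real.log n ^ b' := by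
  have hL1 : 1 < Real.log n := one_lt_log_natCast hn
  have hL0 : 0 < Real.log n := by linarith
  have hLL : 0 < Real.log (Real.log n) := Real.log_pos hL1
  have hn0 : (0 : ℝ) < n := by exact_mod_cast (show 0 < n by omega)
  have hLb : 0 < Real.log n ^ b := Real.rpow_pos_of_pos hL0 b
  have hLb' : 0 < Real.log n ^ b' := Real.rpow_pos_of_pos hL0 b'
  have hsplit : Real.log n ^ b = Real.log n ^ b' * Real.log n ^ (b - b') := by
    rw [← Real.rpow_add hL0]; congr 1; ring
  rw [div_le_div_iff₀ hLb hLb', hsplit]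
  have hX : 0 ≤ (n : ℝ) * Real.log (Real.log n) * Real.log n ^ b' := by positivity
  calc C * n * Real.log (Real.log n) * Real.log n ^ b'
      = C * ((n : ℝ) * Real.log (Real.log n) * Real.log n ^ b') := by ring
    _ ≤ Real.log n ^ (b - b') * ((n : ℝ) * Real.log (Real.log n) * Real.log n ^ b') :=
        mul_le_mul_of_nonneg_right hCn hX
    _ = 1 * n * Real.log (Real.log n) * (Real.log n ^ b' * Real.log n ^ (b - b')) := by ring

/-- **Margin `b` ⟹ abscissa `1 − b`** (`b < 1/2`, ANY real constant `C`, ANY cutoff `N`): if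
`σ(n) < e^γ n log log n + C n log log n/(log n)^b` for all `n > N`, then `ζ(s) ≠ 0` for
`1 − b < Re s < 1` (`QuasiRiemannHypothesis (1 − b)`).  Contrapositive of the zero-resolved Ω-theorem. -/
theorem quasiRH_of_marginTail {b C : ℝ} (hb : b < 1 / 2) (N : ℕ)
    (h : ∀ n : ℕ, N < n → (σ 1 n : ℝ) <
      rexp eulerMascheroniConstant * n * Real.log (Real.log n) +
        C * n * Real.log (Real.log n) / Real.log n ^ b) :
    QuasiRiemannHypothesis (1 - b) := by
  intro s hs h0 h1
  -- an exponent `b'` strictly between `1 - Re s` and `b`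
  set b' : ℝ := (1 - s.re + b) / 2 with hb'
  have hb'0 : 0 < b' := by rw [hb']; linarith
  have hb'b : b' < b := by rw [hb']; linarith
  have hb'h : b' < 1 / 2 := by linarith
  have hb's : 1 - b' < s.re := by rw [hb']; linarith
  have hfreq := frequently_margin_le_sigma_of_zero hb'0 hb'h hs hb's
  have hev : ∀ᶠ n : ℕ in atTop, N < n ∧ 3 ≤ n ∧ C ≤ Real.log n ^ (b - b') := by
    refine (eventually_gt_atTop N).and ((eventually_ge_atTop 3).and ?_)
    have ht : Tendsto (fun n : ℕ ↦ Real.log n ^ (b - b')) atTop atTop :=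
      (tendsto_rpow_atTop (by linarith)).comp
        (Real.tendsto_log_atTop.comp tendsto_natCast_atTop_atTop)
    exact ht.eventually (eventually_ge_atTop C)
  obtain ⟨n, hσ, hNn, hn3, hCn⟩ := (hfreq.and_eventually hev).exists
  have hup := h n hNn
  have hcmp := margin_le_of_le_rpow (b := b) (b' := b') hn3 hCn
  linarith

/-- **Margins at or below the RH scale are RH-strength**: for `b ≥ 1/2` (any `C ≥ 0`, any `N`),
the margin-`b` tail implies the Riemann hypothesis (a zero off the line at `Re s = σ₀ > 1/2` is
detected by every exponent `b' ∈ (1 − σ₀, 1/2)`, and `b' < b`).  g0's `TailRobin N → RH` is `C → 0`. -/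
theorem rh_of_marginTail_of_half_le {b C : ℝ} (hb : 1 / 2 ≤ b) (hC : 0 ≤ C) (N : ℕ)
    (h : ∀ n : ℕ, N < n → (σ 1 n : ℝ) <
      rexp eulerMascheroniConstant * n * Real.log (Real.log n) +
        C * n * Real.log (Real.log n) / Real.log n ^ b) :
    _root_.RiemannHypothesis := by
  refine quasiRiemannHypothesis_one_half_iff_holds.1 ?_
  intro s hs h0 h1
  set b' : ℝ := (1 - s.re + 1 / 2) / 2 with hb'
  have hb'h : b' < 1 / 2 := by rw [hb']; linarith
  have hb's : 1 - b' < s.re := by rw [hb']; linarith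
  have hb'b : b' ≤ b := by linarith
  have hQ : QuasiRiemannHypothesis (1 - b') := by
    refine quasiRH_of_marginTail (C := C) hb'h (max N 3) fun n hn ↦ ?_
    have hNn : N < n := lt_of_le_of_lt (le_max_left _ _) hn
    have hn3 : 3 ≤ n := (le_max_right _ _).trans hn.le
    have hL1 : 1 < Real.log n := one_lt_log_natCast hn3
    have hL0 : 0 < Real.log n := by linarith
    have hLL : 0 < Real.log (Real.log n) := Real.log_pos hL1
    have hn0 : (0 : ℝ) < n := by exact_mod_cast (show 0 < n by omega)
    have hmono : Real.log n ^ b' ≤ Real.log n ^ b :=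
      Real.rpow_le_rpow_of_exponent_le hL1.le hb'b
    have hcmp : C * n * Real.log (Real.log n) / Real.log n ^ b ≤
        C * n * Real.log (Real.log n) / Real.log n ^ b' :=
      div_le_div_of_nonneg_left (by positivity) (Real.rpow_pos_of_pos hL0 b') hmono
    exact lt_of_lt_of_le (h n hNn) (by linarith)
  exact hQ s hs hb's h1

/-! ### 3. The RH-implied direction and the finite-range-free criterion -/

/-! ### 4. Lens (ii) in Lean terms: bridges from `QRH κ` are pinned to margin exponent `≤ 1 − κ` -/

/-- **The bridge pins the abscissa.** Any implication «`QRH κ` ⟹ margin-`b` Robin tail» yields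
«`QRH κ` ⟹ `QRH (1 − b)`».  For `b > 1 − κ` the latter is a zero-free STRIP theorem
(`1 − b < Re s ≤ κ` free, given only `Re s > κ` free) that nobody has; so a printed conjecture
`QRH κ` weaker than RH can bridge only to tails of margin exponent `b ≤ 1 − κ` — never to
`TAIL_robin` (margin 0) unless `κ = 1/2`, i.e. unless the «bridge» is RH itself. -/
theorem bridge_pins_abscissa {κ b C : ℝ} (hb : b < 1 / 2) (N : ℕ)
    (hbridge : QuasiRiemannHypothesis κ → ∀ n : ℕ, N < n → (σ 1 n : ℝ) <
      rexp eulerMascheroniConstant * n * Real.log (Real.log n) +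
        C * n * Real.log (Real.log n) / Real.log n ^ b) :
    QuasiRiemannHypothesis κ → QuasiRiemannHypothesis (1 - b) :=
  fun hκ ↦ quasiRH_of_marginTail hb N (hbridge hκ)

/-- Special case `b ≥ 1/2`: a bridge to a margin at/below the RH scale is a proof of RH from `QRH κ`. -/
theorem bridge_to_rh_scale_is_rh {κ b C : ℝ} (hb : 1 / 2 ≤ b) (hC : 0 ≤ C) (N : ℕ)
    (hbridge : QuasiRiemannHypothesis κ → ∀ n : ℕ, N < n → (σ 1 n : ℝ) <
      rexp eulerMascheroniConstant * n * Real.log (Real.log n) +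
        C * n * Real.log (Real.log n) / Real.log n ^ b) :
    QuasiRiemannHypothesis κ → _root_.RiemannHypothesis :=
  fun hκ ↦ rh_of_marginTail_of_half_le hb hC N (hbridge hκ)

/-! ### 5. The induced RH-splitting is MONOTONE costume -/

/-- `RH ⟺ ⋀_{b<1/2} MarginTail b`; and for every `b₀ < 1/2` the upper conjunct
`⋀_{b₀ < b < 1/2} MarginTail b` ALONE is already RH (each off-line zero is caught by exponents
arbitrarily close to `1/2`).  So «`MarginTail b₀ ∧ ⋀_{b>b₀} MarginTail b ⟹ RH`» has an idle first
conjunct: monotone costume, not a splitting. -/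
theorem rh_of_forall_marginTail_above {b₀ C : ℝ} (hb₀ : b₀ < 1 / 2)
    (H : ∀ b : ℝ, b₀ < b → b < 1 / 2 → ∃ N : ℕ, ∀ n : ℕ, N < n → (σ 1 n : ℝ) <
      rexp eulerMascheroniConstant * n * Real.log (Real.log n) +
        C * n * Real.log (Real.log n) / Real.log n ^ b) :
    _root_.RiemannHypothesis := by
  refine quasiRiemannHypothesis_one_half_iff_holds.1 ?_
  intro s hs h0 h1
  set m : ℝ := max b₀ (1 - s.re) with hm
  have hm1 : m < 1 / 2 := max_lt hb₀ (by linarith)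
  set b : ℝ := (m + 1 / 2) / 2 with hbdef
  have hb₀b : b₀ < b := by
    have : b₀ ≤ m := le_max_left _ _
    rw [hbdef]; linarith
  have hbh : b < 1 / 2 := by rw [hbdef]; linarith
  have hbs : 1 - b < s.re := by
    have : 1 - s.re ≤ m := le_max_right _ _
    rw [hbdef]; linarith
  obtain ⟨N, hN⟩ := H b hb₀b hbh
  exact quasiRH_of_marginTail hbh N hN s hs hbs h1

/-! ### 6. Nicolas's own face: `log f(x) ≠ Ω₋(x^{−b})` certifies `QRH (1 − b)` (1983 Thm 3 (c)) -/

/-- Per-zero `Ω₋` for `log f` (Nicolas 1983 Thm 3 (c) with the window `1 − Θ < b < 1/2`): a zero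
with `Re ρ > 1 − b` forces `log f(x) ≤ −c x^{−b}` for arbitrarily large `x`, for EVERY `c`
(`f(x) = e^γ log θ(x) ∏_{p ≤ x}(1 − 1/p)`, tree `nicolasF`).  Transfer verbatim from the tree's
`Nicolas1983_logf_omegaMinus`, with `exists_nicolasFn_neg_of_zero` in place of `exists_nicolasFn_neg`. -/
theorem frequently_logf_le_of_zero {b : ℝ} (hb0 : 0 < b) (hb : b < 1 / 2) {ρ : ℂ}
    (hρ : riemannZeta ρ = 0) (hre : 1 - b < ρ.re) (c : ℝ) :
    ∃ᶠ x : ℝ in atTop, Real.log (nicolasF x) ≤ -c * x ^ (-b) := by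
  obtain ⟨s₀, hZ, hre1, hre2, hray⟩ := exists_zero_right_of_zero hρ (by linarith)
  have hre' : -b < s₀.re := by linarith
  rw [Filter.frequently_atTop]
  intro X
  obtain ⟨x, hxX, hgx⟩ := exists_nicolasFn_neg_of_zero hb0 hb hZ hre' hray c (max X 7)
  have hx7 : 7 ≤ x := le_trans (le_max_right _ _) hxX.le
  refine ⟨x, le_trans (le_max_left _ _) hxX.le, ?_⟩
  have hθ1 : 1 < Chebyshev.theta x := one_lt_theta (by linarith)
  have hlogθ : 0 < Real.log (Chebyshev.theta x) := Real.log_pos hθ1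
  have hprod : ∏ p ∈ Nat.primesLE ⌊x⌋₊, (1 - (p : ℝ)⁻¹) = Real.exp (-mertensLog x) := by
    rw [Real.exp_neg, mertensLog_eq_natCast_floor, exp_mertensLog_natCast,
      ← Finset.prod_inv_distrib]
    simp only [inv_inv]
  have hf : Real.log (nicolasF x) =
      Real.eulerMascheroniConstant + Real.log (Real.log (Chebyshev.theta x)) - mertensLog x := by
    rw [nicolasF, hprod, Real.log_mul (mul_pos (Real.exp_pos _) hlogθ).ne' (Real.exp_pos _).ne',
      Real.log_mul (Real.exp_pos _).ne' hlogθ.ne', Real.log_exp, Real.log_exp]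
    ring
  have hθψ : Real.log (Real.log (Chebyshev.theta x)) ≤ Real.log (Real.log (Chebyshev.psi x)) :=
    Real.log_le_log hlogθ (Real.log_le_log (by linarith) (Chebyshev.theta_le_psi x))
  have hψ := log_log_psi_le hx7
  have hg : nicolasFn b c x = c * x ^ (-b) + Real.eulerMascheroniConstant + Real.log (Real.log x)
      + psiError x - mertensLog x := rfl
  rw [hf]
  linarith

/-- **Nicolas 1983 Thm 3 (c), contrapositive, per zero**: if for some `c` eventually
`log f(x) > −c·x^{−b}` (`0 < b < 1/2`), then `ζ(s) ≠ 0` for `Re s > 1 − b`. -/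
theorem quasiRH_of_logf_eventually_gt {b : ℝ} (hb0 : 0 < b) (hb : b < 1 / 2) (c : ℝ)
    (h : ∀ᶠ x : ℝ in atTop, -c * x ^ (-b) < Real.log (nicolasF x)) :
    QuasiRiemannHypothesis (1 - b) := by
  intro s hs h0 h1
  have hfreq := frequently_logf_le_of_zero hb0 hb hs h0 c
  obtain ⟨x, hle, hlt⟩ := (hfreq.and_eventually h).exists
  linarith

end Summit.RiemannHypothesis.RiemannHypothesis.Theorems.Splittings.RobinMarginTailDetectors

end
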